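import Literature.MathematicalPhysics.QuantumFieldTheory.ConformalBootstrap3D.PointKernelK34Data

/-!
# K34 certificate, kernel block file H1: head segments `6 ≤ i < 13` of `hsegs`, one theorem per segment (cells checked corner or chord by the rule bit)

`decide` by kernel reduction (no `native_decide`, no extra axioms) of the block checker of
`PointKernel` on the literal data of `PointKernelK34Data`; soundness is `PCert.hBlockOK_sound`.
Estimated kernel time 252 s (7 theorems).
-/

set_option maxRecDepth 100000
set_option maxHeartbeats 0

namespace Literature.MathematicalPhysics.QuantumFieldTheory.ConformalBootstrap3D.PointKernelK34

open Literature.MathematicalPhysics.QuantumFieldTheory.ConformalBootstrap3D.PointKernel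

/-- head segment `[6, 7)` passes the kernel evaluator. [folklore] -/
theorem hBlock_6 : cert.hBlockOK hsegs 6 7 JH = true := by
  decide +kernel

/-- head segment `[7, 8)` passes the kernel evaluator. [folklore] -/
theorem hBlock_7 : cert.hBlockOK hsegs 7 8 JH = true := by
  decide +kernel

/-- head segment `[8, 9)` passes the kernel evaluator. [folklore] -/
theorem hBlock_8 : cert.hBlockOK hsegs 8 9 JH = true := by
  decide +kernel

/-- head segment `[9, 10)` passes the kernel evaluator. [folklore] -/
theorem hBlock_9 : cert.hBlockOK hsegs 9 10 JH = true := by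
  decide +kernel

/-- head segment `[10, 11)` passes the kernel evaluator. [folklore] -/
theorem hBlock_10 : cert.hBlockOK hsegs 10 11 JH = true := by
  decide +kernel

/-- head segment `[11, 12)` passes the kernel evaluator. [folklore] -/
theorem hBlock_11 : cert.hBlockOK hsegs 11 12 JH = true := by
  decide +kernel

/-- head segment `[12, 13)` passes the kernel evaluator. [folklore] -/
theorem hBlock_12 : cert.hBlockOK hsegs 12 13 JH = true := by
  decide +kernel

end Literature.MathematicalPhysics.QuantumFieldTheory.ConformalBootstrap3D.PointKernelK34
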